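import Literature.AlgebraicGeometry.ModuliOfAbelianVarieties.SiegelAdelicCongrTransport
import Literature.AlgebraicGeometry.Motives.AbelianVarietyIsoOfTorsionKernel
import HarnessLib

/-!
# The level-compatibility hypothesis of the Siegel moduli reading makes `f : σA ⟶ A′` an ISOMORPHISM
# ([Milne 2005] Thm. 6.11 p. 74 «an isomorphism `A → A′` … sending `ηK` to `η′K`»; §14 pp. 124–125)

Topic `AlgebraicGeometry/ModuliOfAbelianVarieties`; namespace `Literature.AlgebraicGeometry.ModuliOfAbelianVarieties.SiegelAdelicMarking`.
Cell hodgecm-mathlib (D-0151), #60 road, `B-plan/M1PRIME-DAG.md` §3 N6 / ANNEX B §2 row **I1-(i)**, file (b) = the MARKING-LEVEL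
assembly (B-plan1 routing 21:13:11Z; R60-57b).  THEOREMS ONLY (no definition, no named fact, no instance, no `sorry`; net
Literature debt 0).  Inputs BY NAME, not restated: (a) the generic core ★ R60-57a
`Motives.AbelianVariety.isIso_of_forall_torsionPoints_map_eq_one` (B-p04: a homomorphism of complex abelian varieties of the
same dimension that kills no torsion point is an isomorphism) and the adelic engine ★ R60-58 `SiegelAdelicCongrTransport` (B-p14:
totality `exists_adelicCongr_right`, partners vanish together `SiegelAdelicMarking.r_eq_one_iff_of_adelicCongr`).

## What is proved
The antecedent of ★ `SiegelRationalModel.IsModuli` (T1′, `SiegelModuliInterpretation` :305) — markings `m` of `A` by `[J, a]`,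
`m′` of `A′` by `[J′, a′]`, `σ ∈ Aut(ℂ/ℚ)`, a homomorphism `f : σA ⟶ A′` and `k` with
«`f((u v)^σ) = u′(w)` whenever `k a⁻¹ v̂ ≡ a′⁻¹ ŵ (mod ẑ^{2g})`» — forces, for `k ∈ K_δ(1) = GSp_δ(ẑ)` (in particular for
`k` in any principal level `K.1`, `SiegelLevel.val_le_principalLevelSubgroup_one`), that **`f` is an isomorphism of abelian
varieties** ([Milne2005ShimuraVarieties] p. 74: an isomorphism of triples is «an isomorphism `A → A′` (as objects in `AV⁰`) …
sending `ηK` to `η′K`»; T1′ module docstring «READINGS»: «such an `f` is automatically injective on torsion … hence an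
isomorphism»).  Route (`eq_one_of_map_conjPoints_eq_one`): a torsion point `T` of `σA` killed by `f` is `(u v)^σ`
(★ `AbelianVariety.conjPoints`, ★ T1′ `exists_r_eq_of_zpow_eq_one`); a partner `w` of `v` (★ R60-58 `exists_adelicCongr_right`)
has `u′(w) = f(T) = 1`, hence `u v = 1` (★ R60-58 `r_eq_one_iff_of_adelicCongr`: partners vanish together, `Λ_{a k⁻¹} = Λ_a`),
hence `T = 1`; with `dim σA = dim A = g = dim A′` (★ `dim_conjugate`, ★ `SiegelAdelicMarking.dim_eq`) the core (a) concludes.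
NOT here: the `ℚ^×`-polarisation clause (I1-(ii), needs the analytic↔algebraic Weil-pairing bridge G2) and the packaging of
the exact level clause (I1-(iii) = ★ R60-58 §3).  HC_CM is proved only modulo the 7 printed citations until rung 0 closes.

## References
* [Milne2005ShimuraVarieties] J. S. Milne, *Introduction to Shimura varieties* (2005; held 2017 revision), §6 Thm. 6.11 p. 74,
  §12 (63) p. 116, §14 pp. 124–125 (hypothesis of Prop. 14.12 p. 125).
* [Deligne1971TravauxShimura] P. Deligne, *Travaux de Shimura*, Sém. Bourbaki 389, 4.16 p. 150 («pour `n ≥ 3` les objets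
  classifiés n'ont plus d'automorphismes»), proof of Thm. 4.21 (a)–(c) p. 152.
-/

noncomputable section

open Matrix NumberField IsDedekindDomain CategoryTheory

namespace Literature.AlgebraicGeometry.ModuliOfAbelianVarieties

open Literature.AlgebraicGeometry.Motives (AbelianVariety AlgPoints)

variable {g : ℕ} {δ : Fin g → ℕ}

/-- **`K.1 ≤ K_δ(1)`** for a principal level `K : SiegelLevel δ` (`K.1 = K_δ(N)`, `1 ∣ N`): the antecedent of ★ `IsModuli`
(`∃ k ∈ K.1, …`) supplies a `k ∈ K_δ(1)`. [cite: Deligne1971TravauxShimura, 1.8 p. 129 and Exemple 4.16 p. 150] -/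
theorem SiegelLevel.val_le_principalLevelSubgroup_one (K : SiegelLevel δ) :
    (K.1 : Subgroup (gspFinAdelic δ)) ≤ principalLevelSubgroup δ 1 := by
  rw [K.val_eq]; exact principalLevelSubgroup_anti δ (one_dvd K.N)

namespace SiegelAdelicMarking

variable {J J' : C0pm δ} {a a' : gspFinAdelic δ} {A A' : AbelianVariety ℂ}

/-! ### §1. The torsion kernel of a level-compatible `f` is trivial -/

/-- **THE TORSION KERNEL OF A LEVEL-COMPATIBLE `f : σA ⟶ A′` IS TRIVIAL.**  Under the antecedent of ★ `IsModuli` — `f((u v)^σ) = u′(w)`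
whenever `k a⁻¹ v̂ ≡ a′⁻¹ ŵ (mod ẑ^{2g})`, for some `k ∈ K_δ(1)` — a torsion point `T` of `σA(ℂ)` with `f(T) = 1` is `1`:
`T = (u v)^σ`, a partner `w ≡ k a⁻¹ v̂` has `u′(w) = 1`, and partners vanish together (★ R60-58), so `u v = 1`
([Milne2005ShimuraVarieties] p. 74; T1′ «READINGS»: «such an `f` is automatically injective on torsion»).
[cite: Milne2005ShimuraVarieties, §6 Thm. 6.11 p. 74, §12 (63) p. 116, §14 pp. 124–125] -/
theorem eq_one_of_map_conjPoints_eq_one (m : SiegelAdelicMarking J a A) (m' : SiegelAdelicMarking J' a' A')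
    (σ : ℂ ≃ₐ[ℚ] ℂ) (f : A.conjugate σ.toRingEquiv ⟶ A') {k : gspFinAdelic δ} (hk : k ∈ principalLevelSubgroup δ 1)
    (hf : ∀ v w : Fin g ⊕ Fin g → ℚ,
        AdelicCongr ((k * a⁻¹ : gspFinAdelic δ) : GL (Fin g ⊕ Fin g) finAdeleQ)
            ((a'⁻¹ : gspFinAdelic δ) : GL (Fin g ⊕ Fin g) finAdeleQ) v w →
          AlgPoints.map f.hom.hom.hom (A.conjPoints σ.toRingEquiv (m.r v)) = m'.r w)
    {N : ℤ} (hN : N ≠ 0) {T : (A.conjugate σ.toRingEquiv).Points ℂ}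
    (hT : T ∈ (A.conjugate σ.toRingEquiv).torsionPoints ℂ N) (hfT : AlgPoints.map f.hom.hom.hom T = 1) : T = 1 := by
  -- `T = S^σ` with `S` an `N`-torsion point of `A(ℂ)`, and `S = u v`
  set S : A.Points ℂ := (A.conjPoints σ.toRingEquiv).symm T with hS
  have hTS : T = A.conjPoints σ.toRingEquiv S := by rw [hS, MulEquiv.apply_symm_apply]
  have hSN : S ^ N = 1 := by
    rw [hS, ← map_zpow, (AbelianVariety.mem_torsionPoints_iff N T).1 hT, map_one]
  obtain ⟨v, hv⟩ := m.exists_r_eq_of_zpow_eq_one hN hSN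
  -- a partner `w` of `v`; then `u′(w) = f(T) = 1`, so `u v = 1`
  obtain ⟨w, hvw⟩ := exists_adelicCongr_right ((k * a⁻¹ : gspFinAdelic δ) : GL (Fin g ⊕ Fin g) finAdeleQ)
    ((a'⁻¹ : gspFinAdelic δ) : GL (Fin g ⊕ Fin g) finAdeleQ) v
  have h1 : m'.r w = 1 := by rw [← hf v w hvw, hv, ← hTS, hfT]
  rw [hTS, ← hv, (m.r_eq_one_iff_of_adelicCongr m' hk hvw).2 h1, map_one]

/-- **`σ = 1` form of the torsion-kernel triviality**: for markings `m`, `m′` and a homomorphism `f : A ⟶ A′` with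
`f(u v) = u′(w)` whenever `k a⁻¹ v̂ ≡ a′⁻¹ ŵ (mod ẑ^{2g})` (`k ∈ K_δ(1)`), a torsion point killed by `f` is trivial.
[cite: Milne2005ShimuraVarieties, §6 Thm. 6.11 p. 74] -/
theorem eq_one_of_map_eq_one (m : SiegelAdelicMarking J a A) (m' : SiegelAdelicMarking J' a' A')
    (f : A ⟶ A') {k : gspFinAdelic δ} (hk : k ∈ principalLevelSubgroup δ 1)
    (hf : ∀ v w : Fin g ⊕ Fin g → ℚ,
        AdelicCongr ((k * a⁻¹ : gspFinAdelic δ) : GL (Fin g ⊕ Fin g) finAdeleQ)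
            ((a'⁻¹ : gspFinAdelic δ) : GL (Fin g ⊕ Fin g) finAdeleQ) v w →
          AlgPoints.map f.hom.hom.hom (m.r v) = m'.r w)
    {N : ℤ} (hN : N ≠ 0) {T : A.Points ℂ} (hT : T ∈ A.torsionPoints ℂ N) (hfT : AlgPoints.map f.hom.hom.hom T = 1) :
    T = 1 := by
  obtain ⟨v, hv⟩ := m.exists_r_eq_of_zpow_eq_one hN ((AbelianVariety.mem_torsionPoints_iff N T).1 hT)
  obtain ⟨w, hvw⟩ := exists_adelicCongr_right ((k * a⁻¹ : gspFinAdelic δ) : GL (Fin g ⊕ Fin g) finAdeleQ)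
    ((a'⁻¹ : gspFinAdelic δ) : GL (Fin g ⊕ Fin g) finAdeleQ) v
  have h1 : m'.r w = 1 := by rw [← hf v w hvw, hv, hfT]
  rw [← hv]
  exact (m.r_eq_one_iff_of_adelicCongr m' hk hvw).2 h1

/-! ### §2. I1-(i): the level-compatible `f` is an isomorphism -/

/-- **I1-(i): THE LEVEL-COMPATIBLE `f : σA ⟶ A′` OF THE MODULI READING IS AN ISOMORPHISM OF ABELIAN VARIETIES**
([Milne2005ShimuraVarieties] Thm. 6.11 p. 74: an isomorphism of triples `(A, s, ηK) → (A′, s′, η′K)` is «an isomorphism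
`A → A′` … sending `ηK` to `η′K`»; §14 pp. 124–125 with `σ(A, s, ηK) = (σA, σs, σηK)`).  TYPED over the antecedent of ★
`SiegelRationalModel.IsModuli` with `k ∈ K_δ(1) = GSp_δ(ẑ)`: torsion kernel trivial (§1) + `dim σA = dim A = g = dim A′`
(★ `dim_conjugate`, ★ `dim_eq`) + the generic core ★ R60-57a `Motives.AbelianVariety.isIso_of_forall_torsionPoints_map_eq_one`.
[cite: Milne2005ShimuraVarieties, §6 Thm. 6.11 p. 74, §14 pp. 124–125 (hypothesis of Prop. 14.12 p. 125)]
[cite: Deligne1971TravauxShimura, proof of Thm. 4.21 (a)–(c) p. 152] -/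
theorem isIso_of_forall_adelicCongr (m : SiegelAdelicMarking J a A) (m' : SiegelAdelicMarking J' a' A')
    (σ : ℂ ≃ₐ[ℚ] ℂ) (f : A.conjugate σ.toRingEquiv ⟶ A') {k : gspFinAdelic δ} (hk : k ∈ principalLevelSubgroup δ 1)
    (hf : ∀ v w : Fin g ⊕ Fin g → ℚ,
        AdelicCongr ((k * a⁻¹ : gspFinAdelic δ) : GL (Fin g ⊕ Fin g) finAdeleQ)
            ((a'⁻¹ : gspFinAdelic δ) : GL (Fin g ⊕ Fin g) finAdeleQ) v w →
          AlgPoints.map f.hom.hom.hom (A.conjPoints σ.toRingEquiv (m.r v)) = m'.r w) :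
    IsIso f := by
  refine AbelianVariety.isIso_of_forall_torsionPoints_map_eq_one f ?_
    fun N hN T hT hfT => m.eq_one_of_map_conjPoints_eq_one m' σ f hk hf hN hT hfT
  rw [AbelianVariety.dim_conjugate, m.dim_eq, m'.dim_eq]

/-- **The same over the antecedent of ★ `IsModuli` VERBATIM** (`∃ k ∈ K.1, …` at a principal level `K : SiegelLevel δ`).
[cite: Milne2005ShimuraVarieties, §6 Thm. 6.11 p. 74, §14 pp. 124–125 (hypothesis of Prop. 14.12 p. 125)] -/
theorem isIso_of_exists_forall_adelicCongr (K : SiegelLevel δ) (m : SiegelAdelicMarking J a A)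
    (m' : SiegelAdelicMarking J' a' A') (σ : ℂ ≃ₐ[ℚ] ℂ) (f : A.conjugate σ.toRingEquiv ⟶ A')
    (h : ∃ k ∈ (K.1 : Subgroup (gspFinAdelic δ)), ∀ v w : Fin g ⊕ Fin g → ℚ,
        AdelicCongr ((k * a⁻¹ : gspFinAdelic δ) : GL (Fin g ⊕ Fin g) finAdeleQ)
            ((a'⁻¹ : gspFinAdelic δ) : GL (Fin g ⊕ Fin g) finAdeleQ) v w →
          AlgPoints.map f.hom.hom.hom (A.conjPoints σ.toRingEquiv (m.r v)) = m'.r w) :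
    IsIso f := by
  obtain ⟨k, hk, hf⟩ := h
  exact isIso_of_forall_adelicCongr m m' σ f (K.val_le_principalLevelSubgroup_one hk) hf

/-- **`σ = 1` form: a level-compatible `f : A ⟶ A′` between marked varieties is an isomorphism** (`f(u v) = u′(w)` whenever
`k a⁻¹ v̂ ≡ a′⁻¹ ŵ`, `k ∈ K_δ(1)`). [cite: Milne2005ShimuraVarieties, §6 Thm. 6.11 p. 74] -/
theorem isIso_hom_of_forall_adelicCongr (m : SiegelAdelicMarking J a A) (m' : SiegelAdelicMarking J' a' A')
    (f : A ⟶ A') {k : gspFinAdelic δ} (hk : k ∈ principalLevelSubgroup δ 1)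
    (hf : ∀ v w : Fin g ⊕ Fin g → ℚ,
        AdelicCongr ((k * a⁻¹ : gspFinAdelic δ) : GL (Fin g ⊕ Fin g) finAdeleQ)
            ((a'⁻¹ : gspFinAdelic δ) : GL (Fin g ⊕ Fin g) finAdeleQ) v w →
          AlgPoints.map f.hom.hom.hom (m.r v) = m'.r w) :
    IsIso f :=
  AbelianVariety.isIso_of_forall_torsionPoints_map_eq_one f (by rw [m.dim_eq, m'.dim_eq])
    fun _ hN _ hT hfT => m.eq_one_of_map_eq_one m' f hk hf hN hT hfT

end SiegelAdelicMarking

end Literature.AlgebraicGeometry.ModuliOfAbelianVarieties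

end
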